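import Mathlib.FieldTheory.Fixed
import Mathlib.FieldTheory.Galois.Basic
import Mathlib.LinearAlgebra.FiniteDimensional.Lemmas
import HarnessLib

/-!
# The exponent lemma of Tate's theorem "Hodge–Tate characters are locally algebraic" (Serre, Ch. III App. A.5)

`Proofs`-style file (theorems only: no definition, no named fact, no instance, no `sorry`).

**What is printed.**  Serre, *Abelian ℓ-adic representations* (1968), Ch. III, App. A.5, Theorem 2, (ii) ⇒ (i)
(= Tate's theorem; Serre III-1.2): a character `ψ : Gal(K̄/K)^{ab} → E*` whose components `σ ∘ ψ`
(`σ ∈ Γ_E`) admit Hodge–Tate decompositions with weights `n_σ` is `∏_σ σ⁻¹ χ_{σE}^{n_σ}` near `1`, i.e.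
(III-1.1 Prop. 2) `ψ(i(u)) = ∏_ρ ρ(u)^{-n(ρ)}` on an open subgroup of the units, with INTEGER exponents.
In Serre's proof the integrality of the exponents is read off the linear map `c_K` of A.4 Prop. 5 /
A.5 Exercise 2 ("`φ^{c_K(a_φ)} ∼ χ_E`"), which is `K`-linear and vanishes on the automorphisms `σ ≠ 1`
by the Hodge–Tate decomposition of Lubin–Tate modules (A.4 Prop. 4, A.5 Lemma 2).

**What is proved here** — the ALGEBRAIC SKELETON of that deduction, over an arbitrary finite Galois
extension `M/k` with group `Δ = Gal(M/k)` and an arbitrary `M`-vector space `H` (in the application: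
`k = ℚ_p`, `H = H¹(G_M, ℂ_p)`, `c(α) =` the class of `-α ∘ log ∘ χ_M^{LT}`, `c(τ) = 0` for `τ ≠ τ₁` = Lubin–Tate
modules are Hodge–Tate, `c(τ₁) ≠ 0` = Tate's `H⁰(ℂ_p(χ)) = 0`):
* `comp_sum_smul_toLinearMap` — `σ ∘ (Σ_ρ k_ρ ρ) = Σ_ρ σ(k_ρ) (σρ)` in `End_k(M)`;
* `apply_comp_sum_smul_eq` — for an `M`-linear `c : End_k(M) → H` vanishing on `Δ ∖ {τ₁}`:
  `c(σ ∘ Σ_ρ k_ρ ρ) = σ(k_{σ⁻¹τ₁}) • c(τ₁)`;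
* ★ `eq_sum_intCast_smul_of_apply_comp_eq` — **the exponent lemma**: if moreover `c(τ₁) ≠ 0` and
  `α ∈ End_k(M)` satisfies `c(σ ∘ α) = n_σ • c(τ₁)` with `n_σ ∈ ℤ` for every `σ ∈ Δ`, then
  `α = Σ_ρ n_{τ₁ρ⁻¹} • ρ` (Dedekind–Artin: `Δ` is an `M`-basis of `End_k(M)`, Mathlib
  `linearIndependent_toLinearMap` and `IsGalois.card_aut_eq_finrank`); pointwise form
  `apply_eq_sum_intCast_mul_of_apply_comp_eq`: `α(y) = Σ_ρ n_{τ₁ρ⁻¹} · ρ(y)`.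
Nothing about Galois representations is proved here; this is the linear algebra that turns
"all components Hodge–Tate" into "integer exponents".

## References
* J.-P. Serre, *Abelian ℓ-adic representations and elliptic curves*, McGill lecture notes, Benjamin (1968),
  Ch. III §1.1 Prop. 2, §1.2 Theorem (Tate), App. A.4 Prop. 4–5, A.5 Thm. 2 and Exercise 2. [SerreAbelianLadic1968]
* J. Tate, *p-divisible groups*, Proc. Conf. Local Fields (Driebergen, 1966), Springer (1967), §3.3 Thm. 2, §4 Cor. 2. [Tate1967]
* E. Artin, *Galois Theory* (1944), Thm. 12 (independence of characters) — Mathlib `linearIndependent_toLinearMap`.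
-/

open Module

namespace Literature.NumberTheory.GaloisRepresentations

namespace GaloisBasisExponents

variable {k M H : Type*} [Field k] [Field M] [Algebra k M] [AddCommGroup H] [Module M H]

/-- `σ ∘ (Σ_ρ k_ρ • ρ) = Σ_ρ σ(k_ρ) • (σ * ρ)` in `End_k(M)` (the `M`-module structure on `End_k(M)` is
post-multiplication, `(x • α)(y) = x · α(y)`). [cite: SerreAbelianLadic1968, Ch. III App. A.5, Exercise 1 (a)] -/
theorem comp_sum_smul_toLinearMap [Fintype (M ≃ₐ[k] M)] (σ : M ≃ₐ[k] M) (c : (M ≃ₐ[k] M) → M) :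
    (σ : M →ₐ[k] M).toLinearMap ∘ₗ (∑ ρ, c ρ • ((ρ : M ≃ₐ[k] M) : M →ₐ[k] M).toLinearMap) =
      ∑ ρ, σ (c ρ) • ((σ * ρ : M ≃ₐ[k] M) : M →ₐ[k] M).toLinearMap := by
  ext y
  simp [map_sum, map_mul, AlgEquiv.mul_apply]

/-- **Dedekind–Artin**: the automorphisms `ρ ∈ Gal(M/k)` are `M`-linearly independent in `End_k(M)`.
[cite: SerreAbelianLadic1968, Ch. III App. A.5, Exercise 1 (a) ("the σ ⊗ 1 … form a basis")] -/
theorem linearIndependent_toLinearMap_algEquiv :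
    LinearIndependent M (fun ρ : M ≃ₐ[k] M => ((ρ : M →ₐ[k] M).toLinearMap : M →ₗ[k] M)) :=
  (linearIndependent_toLinearMap k M M).comp _ AlgEquiv.coe_toAlgHom_injective

/-- **Evaluation of `c` on `σ ∘ α`**: if `c : End_k(M) → H` is `M`-linear and kills every `τ ≠ τ₁`, then
`c(σ ∘ Σ_ρ k_ρ ρ) = σ(k_{σ⁻¹τ₁}) • c(τ₁)`. [cite: SerreAbelianLadic1968, Ch. III App. A.5, proof of Thm. 2 and Exercise 2] -/
theorem apply_comp_sum_smul_eq [Fintype (M ≃ₐ[k] M)] (c : (M →ₗ[k] M) →ₗ[M] H) (τ₁ : M ≃ₐ[k] M)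
    (hvan : ∀ τ : M ≃ₐ[k] M, τ ≠ τ₁ → c ((τ : M →ₐ[k] M).toLinearMap) = 0)
    (σ : M ≃ₐ[k] M) (kc : (M ≃ₐ[k] M) → M) :
    c ((σ : M →ₐ[k] M).toLinearMap ∘ₗ (∑ ρ, kc ρ • ((ρ : M ≃ₐ[k] M) : M →ₐ[k] M).toLinearMap)) =
      σ (kc (σ⁻¹ * τ₁)) • c ((τ₁ : M →ₐ[k] M).toLinearMap) := by
  classical
  rw [comp_sum_smul_toLinearMap, map_sum]
  simp_rw [map_smul]
  rw [Finset.sum_eq_single (σ⁻¹ * τ₁)]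
  · rw [mul_inv_cancel_left]
  · intro ρ _ hρ
    have hne' : σ * ρ ≠ τ₁ := fun h => hρ (by rw [← h, inv_mul_cancel_left])
    rw [hvan _ hne', smul_zero]
  · intro h
    exact absurd (Finset.mem_univ _) h

variable [FiniteDimensional k M]

/-- `dim_M End_k(M) = [M : k]` for the post-multiplication structure (a `k`-basis of `M` gives `End_k(M) ≃ M^{[M:k]}`).
[cite: SerreAbelianLadic1968, Ch. III App. A.5, Exercise 1 (a) ("A = End_{ℚ_p}(K) … the σ ⊗ 1 form a basis")] -/
theorem finrank_end_eq : finrank M (M →ₗ[k] M) = finrank k M := by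
  rw [← ((Module.finBasis k M).constr M (M' := M)).finrank_eq, Module.finrank_fintype_fun_eq_card,
    Fintype.card_fin]

variable [IsGalois k M]

/-- **`Gal(M/k)` spans `End_k(M)` over `M`**: every `k`-linear `α : M → M` is `Σ_ρ k_ρ • ρ`.
[cite: SerreAbelianLadic1968, Ch. III App. A.5, Exercise 1 (a)] -/
theorem exists_eq_sum_smul_toLinearMap [Fintype (M ≃ₐ[k] M)] (α : M →ₗ[k] M) :
    ∃ c : (M ≃ₐ[k] M) → M, α = ∑ ρ, c ρ • ((ρ : M ≃ₐ[k] M) : M →ₐ[k] M).toLinearMap := by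
  classical
  haveI : FiniteDimensional M (M →ₗ[k] M) :=
    Module.Finite.equiv ((Module.finBasis k M).constr M (M' := M))
  have hcard : Fintype.card (M ≃ₐ[k] M) = finrank M (M →ₗ[k] M) := by
    rw [finrank_end_eq, ← Nat.card_eq_fintype_card, IsGalois.card_aut_eq_finrank]
  let B : Basis (M ≃ₐ[k] M) M (M →ₗ[k] M) :=
    basisOfLinearIndependentOfCardEqFinrank' _ linearIndependent_toLinearMap_algEquiv hcard
  refine ⟨fun ρ => B.repr α ρ, ?_⟩
  conv_lhs => rw [← B.sum_repr α]
  refine Finset.sum_congr rfl fun ρ _ => ?_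
  simp only [B, coe_basisOfLinearIndependentOfCardEqFinrank']

/-- ★ **The exponent lemma.**  Let `c : End_k(M) → H` be `M`-linear with `c(τ) = 0` for `τ ≠ τ₁` and
`c(τ₁) ≠ 0`.  If `α ∈ End_k(M)` satisfies `c(σ ∘ α) = n_σ • c(τ₁)` with `n_σ ∈ ℤ` for every `σ ∈ Gal(M/k)`,
then `α = Σ_ρ n_{τ₁ρ⁻¹} • ρ`: the coordinates of `α` in the basis `Gal(M/k)` are the INTEGERS `n`.
[cite: SerreAbelianLadic1968, Ch. III App. A.5, Thm. 2 (ii) ⇒ (i)] [cite: Tate1967, §4 Cor. 2] -/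
theorem eq_sum_intCast_smul_of_apply_comp_eq [Fintype (M ≃ₐ[k] M)] (c : (M →ₗ[k] M) →ₗ[M] H)
    (τ₁ : M ≃ₐ[k] M) (hvan : ∀ τ : M ≃ₐ[k] M, τ ≠ τ₁ → c ((τ : M →ₐ[k] M).toLinearMap) = 0)
    (hne : c ((τ₁ : M →ₐ[k] M).toLinearMap) ≠ 0) (α : M →ₗ[k] M) (n : (M ≃ₐ[k] M) → ℤ)
    (hα : ∀ σ : M ≃ₐ[k] M,
      c ((σ : M →ₐ[k] M).toLinearMap ∘ₗ α) = (n σ : M) • c ((τ₁ : M →ₐ[k] M).toLinearMap)) :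
    α = ∑ ρ, ((n (τ₁ * ρ⁻¹) : ℤ) : M) • ((ρ : M ≃ₐ[k] M) : M →ₐ[k] M).toLinearMap := by
  classical
  obtain ⟨kc, rfl⟩ := exists_eq_sum_smul_toLinearMap α
  -- the coordinates are forced: `σ (kc (σ⁻¹ τ₁)) = n σ`
  have hcoord : ∀ σ : M ≃ₐ[k] M, kc (σ⁻¹ * τ₁) = n σ := by
    intro σ
    have h := hα σ
    rw [apply_comp_sum_smul_eq c τ₁ hvan] at h
    have h' : (σ (kc (σ⁻¹ * τ₁)) - (n σ : M)) • c ((τ₁ : M →ₐ[k] M).toLinearMap) = 0 := by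
      rw [sub_smul, h, sub_self]
    have h'' : σ (kc (σ⁻¹ * τ₁)) = (n σ : M) := sub_eq_zero.mp ((smul_eq_zero.mp h').resolve_right hne)
    apply σ.injective
    rw [h'', map_intCast]
  refine Finset.sum_congr rfl fun ρ _ => ?_
  have := hcoord (τ₁ * ρ⁻¹)
  rw [mul_inv_rev, inv_inv, inv_mul_cancel_right] at this
  rw [this]

/-- Pointwise form of the exponent lemma: `α(y) = Σ_ρ n_{τ₁ρ⁻¹} · ρ(y)` — in the application
`log ψ(i(u)) = Σ_ρ n_{τ₁ρ⁻¹} ρ(log u) = log ∏_ρ ρ(u)^{n_{τ₁ρ⁻¹}}`, Serre's III-1.1 Prop. 2 shape.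
[cite: SerreAbelianLadic1968, Ch. III §1.1 Prop. 2 and App. A.5 Thm. 2] -/
theorem apply_eq_sum_intCast_mul_of_apply_comp_eq [Fintype (M ≃ₐ[k] M)] (c : (M →ₗ[k] M) →ₗ[M] H)
    (τ₁ : M ≃ₐ[k] M) (hvan : ∀ τ : M ≃ₐ[k] M, τ ≠ τ₁ → c ((τ : M →ₐ[k] M).toLinearMap) = 0)
    (hne : c ((τ₁ : M →ₐ[k] M).toLinearMap) ≠ 0) (α : M →ₗ[k] M) (n : (M ≃ₐ[k] M) → ℤ)
    (hα : ∀ σ : M ≃ₐ[k] M,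
      c ((σ : M →ₐ[k] M).toLinearMap ∘ₗ α) = (n σ : M) • c ((τ₁ : M →ₐ[k] M).toLinearMap)) (y : M) :
    α y = ∑ ρ, ((n (τ₁ * ρ⁻¹) : ℤ) : M) * (ρ : M ≃ₐ[k] M) y := by
  have h := eq_sum_intCast_smul_of_apply_comp_eq c τ₁ hvan hne α n hα
  conv_lhs => rw [h]
  simp [LinearMap.sum_apply]

/-- The case `τ₁ = 1` (the identity embedding carries the Lubin–Tate weight): `α(y) = Σ_ρ n_{ρ⁻¹} · ρ(y)`.
[cite: SerreAbelianLadic1968, Ch. III App. A.5 Thm. 2] -/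
theorem apply_eq_sum_intCast_mul_of_apply_comp_eq_one [Fintype (M ≃ₐ[k] M)] (c : (M →ₗ[k] M) →ₗ[M] H)
    (hvan : ∀ τ : M ≃ₐ[k] M, τ ≠ 1 → c ((τ : M →ₐ[k] M).toLinearMap) = 0)
    (hne : c ((1 : M ≃ₐ[k] M) : M →ₐ[k] M).toLinearMap ≠ 0) (α : M →ₗ[k] M) (n : (M ≃ₐ[k] M) → ℤ)
    (hα : ∀ σ : M ≃ₐ[k] M,
      c ((σ : M →ₐ[k] M).toLinearMap ∘ₗ α) = (n σ : M) • c (((1 : M ≃ₐ[k] M) : M →ₐ[k] M).toLinearMap))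
    (y : M) : α y = ∑ ρ, ((n ρ⁻¹ : ℤ) : M) * (ρ : M ≃ₐ[k] M) y := by
  rw [apply_eq_sum_intCast_mul_of_apply_comp_eq c 1 hvan hne α n hα y]
  simp only [one_mul]

end GaloisBasisExponents

end Literature.NumberTheory.GaloisRepresentations
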